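import Mathlib
import HarnessLib
import Summits.ValiantsHypothesis.ValiantsHypothesis.Theses.MonotoneRestoration
import Summits.ValiantsHypothesis.ValiantsHypothesis.Theorems.MonotoneRestorationMonotoneRestorationQPDelta
import Summits.ValiantsHypothesis.ValiantsHypothesis.Theorems.MonotoneRestorationMonotoneRestorationQPCommutingRealisation
import Summits.ValiantsHypothesis.ValiantsHypothesis.Theorems.MonotoneRestorationMonotoneRestorationQPScanEval
import Summits.ValiantsHypothesis.ValiantsHypothesis.Theorems.MonotoneRestorationMonotoneRestorationQPLengthFilter
import Summits.ValiantsHypothesis.ValiantsHypothesis.Theorems.MonotoneRestorationMonotoneRestorationQPPermOfSwap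
import Summits.ValiantsHypothesis.ValiantsHypothesis.Theorems.MonotoneRestorationMonotoneRestorationQPSwapRealisation
import Summits.ValiantsHypothesis.ValiantsHypothesis.Theorems.MonotoneRestorationMonotoneRestorationQPTemplateTransport

/-!
# THEOREM δ′ — EXCHANGEABLE ROW SCANS RESTORE with polynomial symmetric size

Support file (`--supports stmt-ValiantsHypothesis-15886`) of line `Sketch`, lead c3 (cycle 1): assembly of the
side stubs D′0–D′3 of the registered skeleton (`Cruxes/MonotoneRestorationQP/Lines/Sketch.lean` v7).

THEOREM δ (`rowScan_symmetric_circuit`, lead c2, p150649) restores ROW SCANS — transfer matrices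
`A_i = H(p_1(r_i),…,p_D(r_i))` with sparse templates `H` in the row power sums, value
`Σ_{a,b} u_a (A_0 ⋯ A_{n-1})_{ab} v_b` — under the hypothesis that the `A_i` pairwise COMMUTE.
THEOREM δ′ (`rowScan_symmetric_circuit_of_rowSymmetric`) removes that hypothesis: it suffices that
the scan VALUE is invariant under permutations of the rows, which is necessary anyway. So every
"order-exploiting LINEAR dynamic programme over the rows" (the risk named in the crux's
`why_might_fail`) with a symmetric output has a `Sym_n`-symmetric circuit over `ℂ` of POLYNOMIAL
size `(n + w(n+1) + D + w²T + Eh + 2)^24`, whatever its presentation.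

Proof. Read the scan as a scalar linear representation `r ↦ A(r) = H(p(r))` on the alphabet `ℂ^n`
of ROWS (not on `ℂ^D`: no algebraic independence of power sums is needed, symmetry is only ever
EVALUATED at points whose rows are the letters — D′0 `stub_scan_eval`, D′2b `stub_swapRealisation`).
Tensoring with the nilpotent shift gives a representation of width `w(n+1)` whose coefficients are
the old ones on words of length `n` and `0` elsewhere, with matrices a FIXED linear combination of
the entries of `A(r)` (D′1 `stub_lengthFilterRealisation`). Row symmetry of the value makes this
filtered series EXCHANGEABLE (D′2 `stub_permOfSwap`: permutations from adjacent transpositions in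
context), so by D6 (`stub_commutingRealisation`, Schützenberger–Fliess minimal realisation, p145902)
it has a realisation of width `≤ w(n+1)` with PAIRWISE COMMUTING matrices `Pm · A⁺(r) · Qm` — again a
fixed linear combination of the template values, i.e. a sparse-template scan (`≤ w²T` monomials,
degree `≤ Eh`) whose polynomial transfer matrices commute (D′3 `stub_scan_templateTransport`,
`MvPolynomial.funext`) and whose value is the original one (D′0 twice). THEOREM δ finishes.
-/

set_option linter.dupNamespace false

namespace Summit.ValiantsHypothesis.ValiantsHypothesis.Theorems

open Literature.Computability.AlgebraicComplexity
open Matrix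

/-- Rewriting a two-sided change of basis of a "`κ`-form" matrix as a `κ`-form matrix: if
`A⁺ = (Σ_{cd} κ k l cd · t cd)_{kl}` then `Pm * A⁺ * Qm = (Σ_{cd} κ' i j cd · t cd)_{ij}` with
`κ' i j cd = Σ_l (Σ_k Pm i k · κ k l cd) · Qm l j = (Pm * κ(·,·,cd) * Qm) i j`. [folklore] -/
theorem deltaPrime_conj_kappa_form {m m' : ℕ} {C : Type} [Fintype C]
    (κ : Fin m → Fin m → C → ℂ) (t : C → ℂ) (Pm : Matrix (Fin m') (Fin m) ℂ)
    (Qm : Matrix (Fin m) (Fin m') ℂ) :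
    Pm * (Matrix.of fun k l : Fin m => ∑ cd : C, κ k l cd * t cd : Matrix (Fin m) (Fin m) ℂ) * Qm =
      (Matrix.of fun i j : Fin m' => ∑ cd : C,
        (∑ l : Fin m, (∑ k : Fin m, Pm i k * κ k l cd) * Qm l j) * t cd :
          Matrix (Fin m') (Fin m') ℂ) := by
  have hM : (Matrix.of fun k l : Fin m => ∑ cd : C, κ k l cd * t cd : Matrix (Fin m) (Fin m) ℂ) =
      ∑ cd : C, t cd • (Matrix.of fun k l : Fin m => κ k l cd : Matrix (Fin m) (Fin m) ℂ) := by
    ext k l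
    simp only [Matrix.of_apply, Matrix.sum_apply, Matrix.smul_apply, smul_eq_mul]
    exact Finset.sum_congr rfl fun cd _ => mul_comm _ _
  rw [hM, Matrix.mul_sum, Matrix.sum_mul]
  ext i j
  simp only [Matrix.sum_apply, Matrix.of_apply, Matrix.mul_smul, Matrix.smul_mul,
    Matrix.smul_apply, smul_eq_mul, Matrix.mul_apply]
  exact Finset.sum_congr rfl fun cd _ => mul_comm _ _

/-- **THEOREM δ′ — EXCHANGEABLE ROW SCANS RESTORE with polynomial symmetric size.** For scan data
`(w, D, H, u, v)` on the `n × n` matrix (transfer matrices `A_i = H(p_1(r_i),…,p_D(r_i))`,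
templates with `≤ T` monomials of degree `≤ Eh`) whose scan value
`Σ_{a,b} u_a (A_0 ⋯ A_{n-1})_{ab} v_b` is merely invariant under permutations of the ROWS — no
commutation of the `A_i` is assumed — the scan value is computed by a `Sym_n`-symmetric labelled
circuit over `ℂ` with at most `(n + w(n+1) + D + w²T + Eh + 2)^24` gates. Proof: the scalar
representation `r ↦ A(r)` on the alphabet `ℂ^n` of rows, tensored with the length-`n` filter
(D′1), is an EXCHANGEABLE recognizable series (D′0, D′2, D′2b: evaluate the polynomial symmetry
at the point whose rows are the letters); its minimal realisation COMMUTES (D6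
`stub_commutingRealisation`, Schützenberger–Fliess) and is a fixed two-sided linear change of the
filtered matrices, hence again given by sparse templates in the row power sums (D′3), so THEOREM δ
(`rowScan_symmetric_circuit`) applies. The feared "order-exploiting linear dynamic programme over
the rows" restores at POLYNOMIAL cost whenever its output is symmetric. [new] -/
theorem rowScan_symmetric_circuit_of_rowSymmetric (n w D T Eh : ℕ)
    (H : Fin w → Fin w → MvPolynomial (Fin D) ℂ)
    (hT : ∀ a b, (H a b).support.card ≤ T) (hE : ∀ a b, (H a b).totalDegree ≤ Eh)
    (u v : Fin w → ℂ)
    (hsym : ∀ σ : Equiv.Perm (Fin n),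
      MvPolynomial.rename (fun p : Fin n × Fin n => (σ p.1, p.2))
        (∑ a : Fin w, ∑ b : Fin w, MvPolynomial.C (u a) *
          (List.ofFn fun i : Fin n => Matrix.of fun a' b' : Fin w => MvPolynomial.aeval
            (fun d : Fin D => ∑ j : Fin n, (MvPolynomial.X (i, j) : MvPolynomial (Fin n × Fin n) ℂ)
              ^ ((d : ℕ) + 1)) (H a' b')).prod a b *
          MvPolynomial.C (v b)) =
        ∑ a : Fin w, ∑ b : Fin w, MvPolynomial.C (u a) *
          (List.ofFn fun i : Fin n => Matrix.of fun a' b' : Fin w => MvPolynomial.aeval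
            (fun d : Fin D => ∑ j : Fin n, (MvPolynomial.X (i, j) : MvPolynomial (Fin n × Fin n) ℂ)
              ^ ((d : ℕ) + 1)) (H a' b')).prod a b *
          MvPolynomial.C (v b)) :
    ∃ (G : Type) (_ : Fintype G) (C : LabelledArithCircuit ℂ (Fin n × Fin n) Unit G),
      C.IsSymmetric (Equiv.Perm (Fin n)) ∧
      C.eval (C.output ()) = ∑ a : Fin w, ∑ b : Fin w, MvPolynomial.C (u a) *
          (List.ofFn fun i : Fin n => Matrix.of fun a' b' : Fin w => MvPolynomial.aeval
            (fun d : Fin D => ∑ j : Fin n, (MvPolynomial.X (i, j) : MvPolynomial (Fin n × Fin n) ℂ)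
              ^ ((d : ℕ) + 1)) (H a' b')).prod a b *
          MvPolynomial.C (v b) ∧
      Fintype.card G ≤ (n + w * (n + 1) + D + w * w * T + Eh + 2) ^ 24 := by
  -- the scalar representation on the alphabet `ℂ^n` of rows and its length-`n` filter (D′1)
  obtain ⟨κ, u₁, v₁, hfilter⟩ := stub_lengthFilterRealisation n
    (fun r : Fin n → ℂ => Matrix.of fun a b : Fin w =>
      MvPolynomial.eval (fun d : Fin D => ∑ j : Fin n, r j ^ ((d : ℕ) + 1)) (H a b)) u v
  -- adjacent transpositions in context do not change the scalar scan (D′0, D′2b, symmetry)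
  have hswap : ∀ (p s : List (Fin n → ℂ)) (a b : Fin n → ℂ), (p ++ a :: b :: s).length = n →
      u ⬝ᵥ (((p ++ a :: b :: s).map fun r : Fin n → ℂ => Matrix.of fun a b : Fin w =>
          MvPolynomial.eval (fun d : Fin D => ∑ j : Fin n, r j ^ ((d : ℕ) + 1)) (H a b)).prod).mulVec v =
      u ⬝ᵥ (((p ++ b :: a :: s).map fun r : Fin n → ℂ => Matrix.of fun a b : Fin w =>
          MvPolynomial.eval (fun d : Fin D => ∑ j : Fin n, r j ^ ((d : ℕ) + 1)) (H a b)).prod).mulVec v := by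
    intro p s a b hlen
    obtain ⟨x, σ, hx1, hx2⟩ := stub_swapRealisation n p s a b hlen
    have h1 := stub_scan_eval n w D H u v x
    have h2 := stub_scan_eval n w D H u v (fun q : Fin n × Fin n => x (σ q.1, q.2))
    rw [hx1] at h1
    rw [hx2] at h2
    rw [← h1, ← h2]
    have h3 := congrArg (MvPolynomial.eval x) (hsym σ)
    rw [MvPolynomial.eval_rename] at h3
    exact h3.symm
  -- exchangeability of the filtered representation (D′2)
  have hex : ∀ l l' : List (Fin n → ℂ), l.Perm l' →
      u₁ ⬝ᵥ ((l.map fun r : Fin n → ℂ => Matrix.of fun i j : Fin (w * (n + 1)) =>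
          ∑ cd : Fin w × Fin w, κ i j cd *
            (Matrix.of fun a b : Fin w => MvPolynomial.eval
              (fun d : Fin D => ∑ j : Fin n, r j ^ ((d : ℕ) + 1)) (H a b)) cd.1 cd.2).prod).mulVec v₁ =
      u₁ ⬝ᵥ ((l'.map fun r : Fin n → ℂ => Matrix.of fun i j : Fin (w * (n + 1)) =>
          ∑ cd : Fin w × Fin w, κ i j cd *
            (Matrix.of fun a b : Fin w => MvPolynomial.eval
              (fun d : Fin D => ∑ j : Fin n, r j ^ ((d : ℕ) + 1)) (H a b)) cd.1 cd.2).prod).mulVec v₁ := by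
    intro l l' hl
    rw [hfilter l, hfilter l']
    by_cases hlen : l.length = n
    · have hlen' : l'.length = n := hl.length_eq ▸ hlen
      rw [if_pos hlen, if_pos hlen']
      exact stub_permOfSwap n (fun l : List (Fin n → ℂ) => u ⬝ᵥ ((l.map fun r : Fin n → ℂ =>
        Matrix.of fun a b : Fin w => MvPolynomial.eval (fun d : Fin D => ∑ j : Fin n, r j ^ ((d : ℕ) + 1))
          (H a b)).prod).mulVec v) hswap l l' hl hlen
    · have hlen' : ¬ l'.length = n := hl.length_eq ▸ hlen
      rw [if_neg hlen, if_neg hlen']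
  -- the commuting minimal realisation (D6)
  obtain ⟨w', A', u', v', Pm, Qm, hw', hcommA', hA', hcoef⟩ := stub_commutingRealisation _ u₁ v₁ hex
  -- its `κ`-form
  have hA'form : ∀ r : Fin n → ℂ, A' r = Matrix.of fun i j : Fin w' =>
      ∑ cd : Fin w × Fin w, (∑ l : Fin (w * (n + 1)), (∑ k : Fin (w * (n + 1)),
        Pm i k * κ k l cd) * Qm l j) *
        MvPolynomial.eval (fun d : Fin D => ∑ j : Fin n, r j ^ ((d : ℕ) + 1)) (H cd.1 cd.2) := by
    intro r
    rw [hA' r]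
    exact deltaPrime_conj_kappa_form κ _ Pm Qm
  -- D′3: back to templates
  obtain ⟨H', hT', hE', hcomm', hH'⟩ := stub_scan_templateTransport n w w' D T Eh H hT hE
    (fun i j cd => ∑ l : Fin (w * (n + 1)), (∑ k : Fin (w * (n + 1)), Pm i k * κ k l cd) * Qm l j)
    (fun r r' => by
      have h := hcommA' r r'
      rwa [hA'form r, hA'form r'] at h)
  -- the value of the new scan is the value of the old one (D′0 twice, D6's coefficients, D′1's filter)
  have hval' : (∑ a : Fin w', ∑ b : Fin w', MvPolynomial.C (u' a) *
          (List.ofFn fun i : Fin n => Matrix.of fun a' b' : Fin w' => MvPolynomial.aeval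
            (fun d : Fin D => ∑ j : Fin n, (MvPolynomial.X (i, j) : MvPolynomial (Fin n × Fin n) ℂ)
              ^ ((d : ℕ) + 1)) (H' a' b')).prod a b *
          MvPolynomial.C (v' b)) =
      ∑ a : Fin w, ∑ b : Fin w, MvPolynomial.C (u a) *
          (List.ofFn fun i : Fin n => Matrix.of fun a' b' : Fin w => MvPolynomial.aeval
            (fun d : Fin D => ∑ j : Fin n, (MvPolynomial.X (i, j) : MvPolynomial (Fin n × Fin n) ℂ)
              ^ ((d : ℕ) + 1)) (H a' b')).prod a b *
          MvPolynomial.C (v b) := by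
    refine MvPolynomial.funext fun x => ?_
    rw [stub_scan_eval n w' D H' u' v' x, stub_scan_eval n w D H u v x]
    have hmap : (List.ofFn fun i : Fin n => fun j : Fin n => x (i, j)).map (fun r : Fin n → ℂ =>
        (Matrix.of fun a b : Fin w' =>
          MvPolynomial.eval (fun d : Fin D => ∑ j : Fin n, r j ^ ((d : ℕ) + 1)) (H' a b) :
          Matrix (Fin w') (Fin w') ℂ)) =
        (List.ofFn fun i : Fin n => fun j : Fin n => x (i, j)).map A' := by
      refine List.map_congr_left fun r _ => ?_
      rw [hA'form r]
      ext a b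
      simp only [Matrix.of_apply, hH']
    have h := hcoef (List.ofFn fun i : Fin n => fun j : Fin n => x (i, j))
    rw [hfilter, if_pos List.length_ofFn] at h
    rw [hmap, h]
  -- THEOREM δ for the commuting scan `(H', u', v')`
  obtain ⟨G, hG, C, hCs, hCe, hCc⟩ :=
    rowScan_symmetric_circuit n w' D (w * w * T) Eh H' hT' hE' u' v' hcomm'
  refine ⟨G, hG, C, hCs, hCe.trans hval', hCc.trans ?_⟩
  exact Nat.pow_le_pow_left (by omega) 24

end Summit.ValiantsHypothesis.ValiantsHypothesis.Theorems
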